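import Literature.Geometry.Kaehler.ComplexTorusMixedHodgeIndexDegreeTwo
import HarnessLib

/-!
# The mixed hard Lefschetz theorem in degree two on a complex torus:
# `A ↦ ω_1 ∧ ⋯ ∧ ω_n ∧ A` is an isomorphism `H²(X, ℂ) ⥲ H^{2n+2}(X, ℂ)`, `Λ^{p,q} ⥲ Λ^{g-q, g-p}` (`p + q = 2`)
# (Dinh–Nguyên 2006, Prop. 2.1 (a) for `p + q = 2` and Remarks 4.2; Timorin 1998)

Layer `Literature/Geometry/Kaehler`, namespace `Literature.Geometry.Kaehler.ComplexTorus`; lane `lit-hodgefound`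
(Track 2 foundations library, Layer A: Hodge theory of complex tori on invariant forms), seat p16, generation 23
(row g23-#1). Sequel of `ComplexTorusMixedHodgeIndexDegreeTwo` (row g22-#1, FILE 2: the mixed intersection form
`(α, β) ↦ (α · β · 𝒞) = Re ∫_X (-α) ∧ (-β) ∧ ⋀ (-η_j)` against a positive `(1,1)` background is symmetric and
NON-DEGENERATE on `H²(X, ℝ)`, of index `(2·C(g,2) + 1, g² - 1)`), and of `ComplexTorusMixedHodgeIndexSubspace` §3
(the mixed hard Lefschetz theorem in bidegree `(1,1)` in its Poincaré-dual form only). Here the OPERATOR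
statement: the wedge with the background monomial `Ω = ω_1 ∧ ⋯ ∧ ω_n` is injective, hence bijective, on all of
`H²(X, ℂ)`, and restricts to bijections `Λ^{p,q} ⥲ Λ^{p+n, q+n} = Λ^{g-q, g-p}` (`p + q = 2`, `g = n + 2`).
THEOREMS ONLY: no definition, no named fact (net debt 0).

## Sources (verbatim, held copies)

* T.-C. Dinh, V.-A. Nguyên, *The mixed Hodge–Riemann bilinear relations for compact Kähler manifolds*, GAFA 16
  (2006) 838–849 [DinhNguyen2006] (held `paper:arxiv-math_0501449`), p. 5 (p0005 L15–L31), **Proposition 2.1**: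
  "`ω_1, …, ω_{n-p-q+1}` strictly positive forms of `Λ^{1,1}(ℂⁿ)` […] `Ω := ω_1 ∧ ⋯ ∧ ω_{n-p-q}`. […] (a) The
  operator of multiplication by `Ω` induces an isomorphism between `Λ^{p,q}(ℂⁿ)` and `Λ^{n-q,n-p}(ℂⁿ)`."
  ("Proof. See Proposition 1, the Main Theorem and Corollary 2 in [Timorin 1998]"); p. 9 (p0009 L81–L83),
  **Remarks 4.2**: "Observe that `Q(·,·)` is positive definite on `H^{2,0}(X) ⊕ H^{0,2}(X)` for `Ω ∈ 𝒦_{n-2}`.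
  Then if `[Ω] ∈ 𝒦^{HR}_{n-2}`, the multiplication by `[Ω]` induces an isomorphism between `H²(X)` and
  `H^{n-2}(X)`" (there `n = dim X`; the target is the cohomology of the complementary degree `2n - 2`, here
  written `H^{2n+2}` for a torus of dimension `n + 2`); p. 4 **Theorem B** (mixed hard Lefschetz).
* V. A. Timorin, *Mixed Hodge–Riemann bilinear relations in a linear context*, Funct. Anal. Appl. 32 (1998)
  268–272 [Timorin1998], Proposition 1 / Main Theorem / Corollary 2 (the linear = torus case).
* D. Huybrechts, *Complex Geometry* (2005) [Huybrechts2005], Prop. 3.3.13 (hard Lefschetz `Lⁿ⁻ᵏ : Hᵏ ≅ H^{2n-k}`)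
  and Cor. 3.3.16 — the unmixed statement; C. Voisin, *Hodge Theory and Complex Algebraic Geometry I* (2002)
  [VoisinHodgeI2002], §6.2.3 Thm. 6.25 (hard Lefschetz), §2.3.1 (types add under `∧`); H. Lange, *Abelian
  Varieties over the Complex Numbers* (2023) [Lange2023AbelianVarietiesComplex], §1.1.3 Cor. 1.1.19
  (`dim H^k(X, ℂ) = C(2g, k)`), §1.1.5 Prop. 1.1.23 (`dim H^{p,q} = C(g,p) C(g,q)`), §2.2.1 p. 89; F. Warner
  [WarnerGTM94], 2.6 (`∧` bilinear, associative, `2`-forms central).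

## What is proved

`X = E/Φ(ℤ^ι)` a complex torus of dimension `n + 2` (`e : Fin (2(n+2)) ≃ ι`), `θ_1, …, θ_n` positive real
`(1,1)`-forms (Kähler forms `ω_m = -θ_m`), `Θ = ((-θ_m)_ℂ)_m` the complexified background and
`Ω := wedgeFamily n Θ = ω_1 ∧ ⋯ ∧ ω_n` (degree `2n`); `A ∧ B ∧ Θ := wedgeFamily (n+2) (A, B, Θ)` as in FILE 2.

1. `wedgeFamily_cons_cons_eq_wedge_wedge`: `A ∧ B ∧ Θ = (Ω ∧ A) ∧ B` (reindexed); `conjForm_wedgeFamily` and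
   `torusIntegral_wedgeFamily_ofRealForm_im`: intersection numbers of real classes are real; the front-slot family
   `(0, 0, θ)` with slots `0, 1` turns FILE 2's `mixedIntersectionForm` into `Re ∫_X (-α)_ℂ ∧ (-β)_ℂ ∧ Θ`
   (`mixedIntersectionForm_vecCons_eq`).
2. **The complex mixed pairing `(A, B) ↦ ∫_X A ∧ B ∧ Θ` is non-degenerate on `H²(X, ℂ)`**
   (`eq_zero_of_forall_torusIntegral_wedgeFamily_cons_cons_eq_zero`): real and imaginary parts + FILE 2's
   `nondegenerate_mixedIntersectionForm`.
3. **Mixed hard Lefschetz in degree two** (Dinh–Nguyên Remarks 4.2 / Thm. B for `k = 2` on a torus):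
   `A ↦ Ω ∧ A` is injective on `H²(X, ℂ)` (`wedgeFamily_wedge_injective`) and bijective onto `H^{2n+2}(X, ℂ)`
   (`wedgeFamily_wedge_bijective`: `dim_ℂ = C(2n+4, 2) = C(2n+4, 2n+2)`); in particular `Ω ∧ α_ℂ = 0 ⇒ α = 0`
   for real classes and `Ω ≠ 0`.
4. **Prop. 2.1 (a) for `p + q = 2`**: `Ω ∧ Λ^{p,q} ⊆ Λ^{n+p, n+q}` (types add) and
   `A ↦ Ω ∧ A : Λ^{p,q} ⥲ Λ^{n+p, n+q} = Λ^{g-q, g-p}` is a bijection (`wedgeFamily_wedge_bijective_typeSubmodule`;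
   `dim = C(g,p) C(g,q)` on both sides).
5. `IsRiemannForm.` readings: `Ω = c₁(L_1) ∧ ⋯ ∧ c₁(L_n)` for polarisations `L_m` of an abelian variety.

NOT claimed: degrees `k ≠ 2` (Theorem B in general), compact Kähler manifolds other than tori, semi-positive
backgrounds (there `Ω ∧ ·` can fail to be injective: Dinh–Nguyên §4, the set `𝓛_{n-2}`).
-/

noncomputable section

set_option maxSynthPendingDepth 3

open scoped ComplexOrder ComplexConjugate
open Module Complex Function
open Literature.LinearAlgebra.Alternating
open Literature.Analysis.Complex (oneForm₀ IsOfTypeAt typeSubmodule isOfTypeAt_of_mem_typeSubmodule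
  finrank_typeSubmodule finrank_alt_real_complex)

namespace Literature.Geometry.Kaehler

namespace ComplexTorus

/-! ## §1 `A ∧ B ∧ Θ = (Ω ∧ A) ∧ B`, conjugation of monomials, realness of intersection numbers, and the
front-slot family of the mixed intersection form -/

section Structure

variable {E : Type*} [NormedAddCommGroup E] [NormedSpace ℂ E]

/-- **`A ∧ B ∧ θ_1 ∧ ⋯ ∧ θ_n = ((θ_1 ∧ ⋯ ∧ θ_n) ∧ A) ∧ B`** up to reindexing of the degree (`2`-forms are central;
associativity of `∧`). [cite: WarnerGTM94, 2.6] [cite: Lange2023AbelianVarietiesComplex, §7.3.1] -/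
theorem wedgeFamily_cons_cons_eq_wedge_wedge (n : ℕ) (A B : E [⋀^Fin 2]→L[ℝ] ℂ) (θ : Fin n → E [⋀^Fin 2]→L[ℝ] ℂ) :
    wedgeFamily (n + 2) (Matrix.vecCons A (Matrix.vecCons B θ)) =
      (((wedgeFamily n θ).wedge A).wedge B).domDomCongr (finCongr (by ring)) := by
  refine GForm.of_injective (2 * (n + 2)) ?_
  rw [GForm.of_domDomCongr_finCongr, gof_wedgeFamily_cons_cons, ← GForm.of_mul_of, ← GForm.of_mul_of, mul_assoc]

/-- `A ∧ B ∧ Θ = 0` as soon as `Ω ∧ A = 0`, `Ω = θ_1 ∧ ⋯ ∧ θ_n`. [cite: WarnerGTM94, 2.6] -/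
theorem wedgeFamily_cons_cons_eq_zero_of_wedge_left_eq_zero {n : ℕ} {A : E [⋀^Fin 2]→L[ℝ] ℂ}
    {θ : Fin n → E [⋀^Fin 2]→L[ℝ] ℂ} (h : (wedgeFamily n θ).wedge A = 0) (B : E [⋀^Fin 2]→L[ℝ] ℂ) :
    wedgeFamily (n + 2) (Matrix.vecCons A (Matrix.vecCons B θ)) = 0 :=
  GForm.of_injective (2 * (n + 2)) (by
    rw [gof_wedgeFamily_cons_cons, ← mul_assoc, GForm.of_mul_of (2 * n) 2, h, GForm.of_zero, zero_mul,
      GForm.of_zero])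

/-- **Conjugation of a wedge monomial**: `conj (θ_1 ∧ ⋯ ∧ θ_p) = θ̄_1 ∧ ⋯ ∧ θ̄_p`. [cite: VoisinHodgeI2002, §2.3.1]
[cite: Lange2023AbelianVarietiesComplex, §1.1.5 Thm. 1.1.21] -/
theorem conjForm_wedgeFamily (p : ℕ) (θ : Fin p → E [⋀^Fin 2]→L[ℝ] ℂ) :
    conjForm (wedgeFamily p θ) = wedgeFamily p (fun j ↦ conjForm (θ j)) := by
  refine GForm.of_injective (2 * p) ?_
  rw [← GForm.conjG_of, gof_wedgeFamily, gof_wedgeFamily, conjG_prod_ofFn]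
  exact congrArg (fun f : Fin p → GForm E ℂ ↦ (List.ofFn f).prod) (funext fun j ↦ GForm.conjG_of 2 (θ j))

/-- A monomial of complexified REAL forms is its own conjugate. [cite: Lange2023AbelianVarietiesComplex, §1.1.5 Thm. 1.1.21] -/
theorem conjForm_wedgeFamily_ofRealForm (p : ℕ) (F : Fin p → E [⋀^Fin 2]→L[ℝ] ℝ) :
    conjForm (wedgeFamily p (fun j ↦ ofRealForm (F j))) = wedgeFamily p (fun j ↦ ofRealForm (F j)) := by
  rw [conjForm_wedgeFamily]
  simp only [conjForm_ofRealForm]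

/-- The front-slot family of complexified real forms, as one complexified family. [folklore] -/
private theorem vecCons_vecCons_ofRealForm {n : ℕ} (a b : E [⋀^Fin 2]→L[ℝ] ℝ) (f : Fin n → E [⋀^Fin 2]→L[ℝ] ℝ) :
    (Matrix.vecCons (ofRealForm a) (Matrix.vecCons (ofRealForm b) fun m ↦ ofRealForm (f m)) :
        Fin (n + 2) → E [⋀^Fin 2]→L[ℝ] ℂ) =
      fun j ↦ ofRealForm (Matrix.vecCons a (Matrix.vecCons b f) j) := by
  funext j
  refine Fin.cases ?_ (fun j ↦ Fin.cases ?_ (fun j ↦ ?_) j) j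
  · simp only [Matrix.cons_val_zero]
  · simp only [Matrix.cons_val_succ, Matrix.cons_val_zero]
  · simp only [Matrix.cons_val_succ]

variable {ι : Type*} [Fintype ι] [DecidableEq ι] (Φ : (ι → ℝ) ≃L[ℝ] E)

omit [Fintype ι] in
/-- **Intersection numbers of real classes are real**: `∫_X F_1 ∧ ⋯ ∧ F_p ∈ ℝ` for real `2`-forms `F_j` (the top
form is real). [cite: Lange2023AbelianVarietiesComplex, §2.2.1 p. 89] -/
theorem torusIntegral_wedgeFamily_ofRealForm_im {p : ℕ} (e : Fin (2 * p) ≃ ι) (F : Fin p → E [⋀^Fin 2]→L[ℝ] ℝ) :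
    (torusIntegral Φ e (wedgeFamily p (fun j ↦ ofRealForm (F j)))).im = 0 := by
  have h := torusIntegral_conjForm Φ e (wedgeFamily p (fun j ↦ ofRealForm (F j)))
  rw [conjForm_wedgeFamily_ofRealForm] at h
  exact Complex.conj_eq_iff_im.1 h.symm

omit [Fintype ι] in
/-- `∫_X a_ℂ ∧ b_ℂ ∧ ⋀ (f_m)_ℂ` is real for real `a`, `b`, `f_m` (front-slot form). [cite: Lange2023AbelianVarietiesComplex, §2.2.1 p. 89] -/
theorem torusIntegral_wedgeFamily_cons_cons_ofRealForm_im {n : ℕ} (e : Fin (2 * (n + 2)) ≃ ι)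
    (a b : E [⋀^Fin 2]→L[ℝ] ℝ) (f : Fin n → E [⋀^Fin 2]→L[ℝ] ℝ) :
    (torusIntegral Φ e (wedgeFamily (n + 2) (Matrix.vecCons (ofRealForm a)
      (Matrix.vecCons (ofRealForm b) fun m ↦ ofRealForm (f m))))).im = 0 := by
  rw [vecCons_vecCons_ofRealForm, torusIntegral_wedgeFamily_ofRealForm_im]

omit [Fintype ι] in
/-- `∫_X a_ℂ ∧ b_ℂ ∧ ⋀ (f_m)_ℂ = Re ∫_X a_ℂ ∧ b_ℂ ∧ ⋀ (f_m)_ℂ` (as a complex number) for real forms.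
[cite: Lange2023AbelianVarietiesComplex, §2.2.1 p. 89] -/
theorem torusIntegral_wedgeFamily_cons_cons_ofRealForm_eq_re {n : ℕ} (e : Fin (2 * (n + 2)) ≃ ι)
    (a b : E [⋀^Fin 2]→L[ℝ] ℝ) (f : Fin n → E [⋀^Fin 2]→L[ℝ] ℝ) :
    torusIntegral Φ e (wedgeFamily (n + 2) (Matrix.vecCons (ofRealForm a)
        (Matrix.vecCons (ofRealForm b) fun m ↦ ofRealForm (f m)))) =
      ((torusIntegral Φ e (wedgeFamily (n + 2) (Matrix.vecCons (ofRealForm a)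
        (Matrix.vecCons (ofRealForm b) fun m ↦ ofRealForm (f m))))).re : ℂ) :=
  Complex.ext (by rw [Complex.ofReal_re])
    (by rw [Complex.ofReal_im, torusIntegral_wedgeFamily_cons_cons_ofRealForm_im])

/-- Slots `≠ 0, 1` of `Fin (n + 2)` are double successors. [folklore] -/
private theorem exists_eq_succ_succ {n : ℕ} {j : Fin (n + 2)} (h0 : j ≠ 0) (h1 : j ≠ 1) :
    ∃ m : Fin n, j = m.succ.succ := by
  obtain ⟨j', rfl⟩ := Fin.exists_succ_eq_of_ne_zero h0
  have hj' : j' ≠ 0 := by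
    rintro rfl
    exact h1 Fin.succ_zero_eq_one
  obtain ⟨m, rfl⟩ := Fin.exists_succ_eq_of_ne_zero hj'
  exact ⟨m, rfl⟩

omit [Fintype ι] [DecidableEq ι] in
/-- The background hypotheses of the family `(0, 0, θ)` off the slots `0, 1` are hypotheses on `θ`. [folklore] -/
private theorem background_vecCons {n : ℕ} {θ : Fin n → E [⋀^Fin 2]→L[ℝ] ℝ} {P : (E [⋀^Fin 2]→L[ℝ] ℝ) → Prop}
    (h : ∀ m, P (θ m)) :
    ∀ j : Fin (n + 2), j ≠ 0 → j ≠ 1 → P (Matrix.vecCons (0 : E [⋀^Fin 2]→L[ℝ] ℝ) (Matrix.vecCons 0 θ) j) := by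
  intro j h0 h1
  obtain ⟨m, rfl⟩ := exists_eq_succ_succ h0 h1
  simp only [Matrix.cons_val_succ]
  exact h m

omit [Fintype ι] in
/-- **The mixed intersection form of FILE 2 in front-slot form**: for the family `(0, 0, θ_1, …, θ_n)` with the
free slots `0, 1`, `(α · β · 𝒞) = Re ∫_X (-α)_ℂ ∧ (-β)_ℂ ∧ ⋀_m (-θ_m)_ℂ`.
[cite: DinhNguyen2006, §1 (1.2) and Theorem 1.3 (arXiv PDF p. 3)] [cite: Lange2023AbelianVarietiesComplex, §2.2.1 p. 89] -/
theorem mixedIntersectionForm_vecCons_eq {n : ℕ} (e : Fin (2 * (n + 2)) ≃ ι) (θ : Fin n → E [⋀^Fin 2]→L[ℝ] ℝ)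
    (α β : E [⋀^Fin 2]→L[ℝ] ℝ) :
    mixedIntersectionForm Φ e (Matrix.vecCons (0 : E [⋀^Fin 2]→L[ℝ] ℝ) (Matrix.vecCons 0 θ)) Fin.zero_ne_one α β =
      (torusIntegral Φ e (wedgeFamily (n + 2) (Matrix.vecCons (ofRealForm (-α))
        (Matrix.vecCons (ofRealForm (-β)) fun m ↦ ofRealForm (-(θ m)))))).re := by
  rw [mixedIntersectionForm_eq_re_torusIntegral_cons_cons Φ e _ Fin.zero_ne_one 1 rfl rfl]
  simp only [Equiv.Perm.coe_one, id_eq, Matrix.cons_val_succ]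

end Structure

/-! ## §2 Non-degeneracy of the complex mixed pairing `(A, B) ↦ ∫_X A ∧ B ∧ ω_1 ∧ ⋯ ∧ ω_n` on `H²(X, ℂ)` -/

section Pairing

variable {ι : Type*} [Fintype ι] [DecidableEq ι] {E : Type*} [NormedAddCommGroup E] [NormedSpace ℂ E]
  (Φ : (ι → ℝ) ≃L[ℝ] E)

/-- **Real classes: `Re ∫_X α_ℂ ∧ β_ℂ ∧ Θ = 0` for all real `β` forces `α = 0`** (FILE 2's non-degeneracy of the
mixed intersection form `(· · · · 𝒞)` on `H²(X, ℝ)`, in front-slot form).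
[cite: DinhNguyen2006, §4 Remarks 4.2 (arXiv PDF p. 9)] [cite: Huybrechts2005, Cor. 3.3.16] -/
theorem eq_zero_of_forall_re_torusIntegral_wedgeFamily_cons_cons_eq_zero {n : ℕ} (e : Fin (2 * (n + 2)) ≃ ι)
    {θ : Fin n → E [⋀^Fin 2]→L[ℝ] ℝ} (h11 : ∀ m (x y : E), θ m ![I • x, I • y] = θ m ![x, y])
    (hpos : ∀ m (v : E), v ≠ 0 → 0 < θ m ![I • v, v]) {α : E [⋀^Fin 2]→L[ℝ] ℝ}
    (hα : ∀ β : E [⋀^Fin 2]→L[ℝ] ℝ, (torusIntegral Φ e (wedgeFamily (n + 2) (Matrix.vecCons (ofRealForm α)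
      (Matrix.vecCons (ofRealForm β) fun m ↦ ofRealForm (-(θ m)))))).re = 0) :
    α = 0 := by
  have hnd := nondegenerate_mixedIntersectionForm Φ e (η := Matrix.vecCons (0 : E [⋀^Fin 2]→L[ℝ] ℝ)
    (Matrix.vecCons 0 θ)) (background_vecCons (P := fun ζ ↦ ∀ x y : E, ζ ![I • x, I • y] = ζ ![x, y]) h11)
    Fin.zero_ne_one (background_vecCons (P := fun ζ ↦ ∀ v : E, v ≠ 0 → 0 < ζ ![I • v, v]) hpos)
  have h := hnd.1 (-α) fun β ↦ by
    rw [mixedIntersectionForm_vecCons_eq, neg_neg, ofRealForm_neg β, ← neg_neg (ofRealForm α), ← ofRealForm_neg α,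
      wedgeFamily_cons_cons_neg_neg, ofRealForm_neg, ← neg_one_smul ℂ (ofRealForm α),
      wedgeFamily_cons_cons_smul_left, torusIntegral_smul, neg_one_mul, Complex.neg_re, hα β, neg_zero]
  exact neg_eq_zero.1 h

/-- **The complex mixed pairing `(A, B) ↦ ∫_X A ∧ B ∧ ω_1 ∧ ⋯ ∧ ω_n` is non-degenerate on `H²(X, ℂ)`** for positive
`(1,1)`-forms `θ_m` (`ω_m = -θ_m`) on a complex torus of dimension `n + 2`: `∫_X A ∧ B ∧ Θ = 0` for all `B`
forces `A = 0` (split `A = a_ℂ + i b_ℂ`; against real `B` both `∫ a_ℂ ∧ B ∧ Θ` and `∫ b_ℂ ∧ B ∧ Θ` are real, so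
both vanish, and the real form is non-degenerate). This is the Poincaré-dual form of Remarks 4.2 ("the
multiplication by `[Ω]` induces an isomorphism between `H²(X)` and" the complementary cohomology).
[cite: DinhNguyen2006, §4 Remarks 4.2 and §2 Prop. 2.1 (a) (arXiv PDF pp. 9, 5)] [cite: Timorin1998, Main Theorem and Corollary 2] -/
theorem eq_zero_of_forall_torusIntegral_wedgeFamily_cons_cons_eq_zero {n : ℕ} (e : Fin (2 * (n + 2)) ≃ ι)
    {θ : Fin n → E [⋀^Fin 2]→L[ℝ] ℝ} (h11 : ∀ m (x y : E), θ m ![I • x, I • y] = θ m ![x, y])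
    (hpos : ∀ m (v : E), v ≠ 0 → 0 < θ m ![I • v, v]) {A : E [⋀^Fin 2]→L[ℝ] ℂ}
    (hA : ∀ B : E [⋀^Fin 2]→L[ℝ] ℂ, torusIntegral Φ e (wedgeFamily (n + 2) (Matrix.vecCons A
      (Matrix.vecCons B fun m ↦ ofRealForm (-(θ m))))) = 0) :
    A = 0 := by
  -- the real and imaginary parts of `A` pair to zero with every real class
  have key : ∀ β : E [⋀^Fin 2]→L[ℝ] ℝ,
      torusIntegral Φ e (wedgeFamily (n + 2) (Matrix.vecCons (ofRealForm (reForm A))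
          (Matrix.vecCons (ofRealForm β) fun m ↦ ofRealForm (-(θ m))))) = 0 ∧
        torusIntegral Φ e (wedgeFamily (n + 2) (Matrix.vecCons (ofRealForm (imForm A))
          (Matrix.vecCons (ofRealForm β) fun m ↦ ofRealForm (-(θ m))))) = 0 := by
    intro β
    set x := torusIntegral Φ e (wedgeFamily (n + 2) (Matrix.vecCons (ofRealForm (reForm A))
      (Matrix.vecCons (ofRealForm β) fun m ↦ ofRealForm (-(θ m))))) with hx
    set y := torusIntegral Φ e (wedgeFamily (n + 2) (Matrix.vecCons (ofRealForm (imForm A))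
      (Matrix.vecCons (ofRealForm β) fun m ↦ ofRealForm (-(θ m))))) with hy
    have hxim : x.im = 0 := torusIntegral_wedgeFamily_cons_cons_ofRealForm_im Φ e (reForm A) β fun m ↦ -(θ m)
    have hyim : y.im = 0 := torusIntegral_wedgeFamily_cons_cons_ofRealForm_im Φ e (imForm A) β fun m ↦ -(θ m)
    have hsum : x + I * y = 0 := by
      have h := hA (ofRealForm β)
      rw [← ofRealForm_reForm_add A, wedgeFamily_cons_cons_add_left, wedgeFamily_cons_cons_smul_left,
        torusIntegral_add, torusIntegral_smul] at h
      exact h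
    have hre : x.re = 0 := by
      have h := congrArg Complex.re hsum
      rw [Complex.add_re, Complex.mul_re, Complex.I_re, Complex.I_im, hyim, zero_mul, one_mul, sub_zero,
        add_zero, Complex.zero_re] at h
      exact h
    have hyre : y.re = 0 := by
      have h := congrArg Complex.im hsum
      rw [Complex.add_im, Complex.mul_im, Complex.I_re, Complex.I_im, hxim, zero_mul, one_mul, zero_add,
        zero_add, Complex.zero_im] at h
      exact h
    exact ⟨Complex.ext (by rw [hre, Complex.zero_re]) (by rw [hxim, Complex.zero_im]),
      Complex.ext (by rw [hyre, Complex.zero_re]) (by rw [hyim, Complex.zero_im])⟩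
  have ha : reForm A = 0 := eq_zero_of_forall_re_torusIntegral_wedgeFamily_cons_cons_eq_zero Φ e h11 hpos
    fun β ↦ by rw [(key β).1, Complex.zero_re]
  have hb : imForm A = 0 := eq_zero_of_forall_re_torusIntegral_wedgeFamily_cons_cons_eq_zero Φ e h11 hpos
    fun β ↦ by rw [(key β).2, Complex.zero_re]
  rw [← ofRealForm_reForm_add A, ha, hb, ofRealForm_zero, smul_zero, add_zero]

/-- **Right non-degeneracy**: `∫_X A ∧ B ∧ Θ = 0` for all `A` forces `B = 0` (the pairing is symmetric).
[cite: DinhNguyen2006, §4 Remarks 4.2 (arXiv PDF p. 9)] [cite: Lange2023AbelianVarietiesComplex, §2.2.1 p. 89] -/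
theorem eq_zero_of_forall_torusIntegral_wedgeFamily_cons_cons_eq_zero_right {n : ℕ} (e : Fin (2 * (n + 2)) ≃ ι)
    {θ : Fin n → E [⋀^Fin 2]→L[ℝ] ℝ} (h11 : ∀ m (x y : E), θ m ![I • x, I • y] = θ m ![x, y])
    (hpos : ∀ m (v : E), v ≠ 0 → 0 < θ m ![I • v, v]) {B : E [⋀^Fin 2]→L[ℝ] ℂ}
    (hB : ∀ A : E [⋀^Fin 2]→L[ℝ] ℂ, torusIntegral Φ e (wedgeFamily (n + 2) (Matrix.vecCons A
      (Matrix.vecCons B fun m ↦ ofRealForm (-(θ m))))) = 0) :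
    B = 0 :=
  eq_zero_of_forall_torusIntegral_wedgeFamily_cons_cons_eq_zero Φ e h11 hpos fun A ↦ by
    rw [wedgeFamily_cons_cons_comm]; exact hB A

end Pairing

/-! ## §3 The mixed hard Lefschetz theorem in degree two: `A ↦ Ω ∧ A` is an isomorphism
`H²(X, ℂ) ⥲ H^{2n+2}(X, ℂ)` -/

section HardLefschetz

variable {ι : Type*} [Fintype ι] [DecidableEq ι] {E : Type*} [NormedAddCommGroup E] [NormedSpace ℂ E]
  (Φ : (ι → ℝ) ≃L[ℝ] E)

include Φ in
/-- **The mixed hard Lefschetz theorem in degree two on a complex torus, injectivity**: for positive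
`(1,1)`-forms `θ_1, …, θ_n` on `X` of dimension `n + 2` and `Ω = ω_1 ∧ ⋯ ∧ ω_n` (`ω_m = -θ_m`), the map
`A ↦ Ω ∧ A`, `H²(X, ℂ) → H^{2n+2}(X, ℂ)`, is injective (`Ω ∧ A = 0` kills all the numbers `∫_X A ∧ B ∧ Θ`).
[cite: DinhNguyen2006, §4 Remarks 4.2 and §1 Theorem B (arXiv PDF pp. 9, 4)] [cite: Timorin1998, Main Theorem and Corollary 2] -/
theorem wedgeFamily_wedge_injective {n : ℕ} (e : Fin (2 * (n + 2)) ≃ ι) {θ : Fin n → E [⋀^Fin 2]→L[ℝ] ℝ}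
    (h11 : ∀ m (x y : E), θ m ![I • x, I • y] = θ m ![x, y]) (hpos : ∀ m (v : E), v ≠ 0 → 0 < θ m ![I • v, v]) :
    Function.Injective fun A : E [⋀^Fin 2]→L[ℝ] ℂ ↦ (wedgeFamily n fun m ↦ ofRealForm (-(θ m))).wedge A := by
  set L : (E [⋀^Fin 2]→L[ℝ] ℂ) →ₗ[ℂ] (E [⋀^Fin (2 * n + 2)]→L[ℝ] ℂ) :=
    { toFun := fun A ↦ (wedgeFamily n fun m ↦ ofRealForm (-(θ m))).wedge A
      map_add' := fun A B ↦ ContinuousAlternatingMap.wedge_add_right _ _ _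
      map_smul' := fun c A ↦ wedge_smul_right_complex c _ _ } with hL
  change Function.Injective L
  rw [injective_iff_map_eq_zero]
  intro A hA
  exact eq_zero_of_forall_torusIntegral_wedgeFamily_cons_cons_eq_zero Φ e h11 hpos fun B ↦ by
    rw [wedgeFamily_cons_cons_eq_zero_of_wedge_left_eq_zero hA B, torusIntegral_zero]

include Φ in
/-- **The mixed hard Lefschetz theorem in degree two on a complex torus**: `A ↦ Ω ∧ A` is a bijection
`H²(X, ℂ) ⥲ H^{2n+2}(X, ℂ)` (injective, and `dim_ℂ H²(X, ℂ) = C(2n+4, 2) = C(2n+4, 2n+2) = dim_ℂ H^{2n+2}(X, ℂ)`)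
— "the multiplication by `[Ω]` induces an isomorphism between `H²(X)` and" the cohomology of the complementary
degree (Remarks 4.2; Thm. B for `k = 2` on a torus; Huybrechts Prop. 3.3.13 with `ω^{n-k}` replaced by a product
of Kähler classes). [cite: DinhNguyen2006, §4 Remarks 4.2 and §1 Theorem B (arXiv PDF pp. 9, 4)]
[cite: Timorin1998, Main Theorem and Corollary 2] [cite: Huybrechts2005, §3.3 Prop. 3.3.13]
[cite: Lange2023AbelianVarietiesComplex, §1.1.3 Cor. 1.1.19] -/
theorem wedgeFamily_wedge_bijective {n : ℕ} (e : Fin (2 * (n + 2)) ≃ ι) {θ : Fin n → E [⋀^Fin 2]→L[ℝ] ℝ}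
    (h11 : ∀ m (x y : E), θ m ![I • x, I • y] = θ m ![x, y]) (hpos : ∀ m (v : E), v ≠ 0 → 0 < θ m ![I • v, v]) :
    Function.Bijective fun A : E [⋀^Fin 2]→L[ℝ] ℂ ↦ (wedgeFamily n fun m ↦ ofRealForm (-(θ m))).wedge A := by
  haveI := finiteDimensional_complex Φ
  haveI := finiteDimensional_complexForms Φ e (k := 2) (by omega)
  haveI := finiteDimensional_complexForms Φ e (k := 2 * n + 2) (by omega)
  have hg : finrank ℂ E = n + 2 := finrank_eq_of_finTwoMulEquiv Φ e
  set L : (E [⋀^Fin 2]→L[ℝ] ℂ) →ₗ[ℂ] (E [⋀^Fin (2 * n + 2)]→L[ℝ] ℂ) :=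
    { toFun := fun A ↦ (wedgeFamily n fun m ↦ ofRealForm (-(θ m))).wedge A
      map_add' := fun A B ↦ ContinuousAlternatingMap.wedge_add_right _ _ _
      map_smul' := fun c A ↦ wedge_smul_right_complex c _ _ } with hL
  have hinj : Function.Injective L := wedgeFamily_wedge_injective Φ e h11 hpos
  refine ⟨hinj, ?_⟩
  change Function.Surjective L
  refine (LinearMap.injective_iff_surjective_of_finrank_eq_finrank ?_).1 hinj
  rw [finrank_alt_real_complex E 2, finrank_alt_real_complex E (2 * n + 2), hg]
  exact Nat.choose_symm_of_eq_add (by ring)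

include Φ in
/-- **Every class of `H^{2n+2}(X, ℂ)` is `Ω ∧ A` for a unique `A ∈ H²(X, ℂ)`.**
[cite: DinhNguyen2006, §4 Remarks 4.2 (arXiv PDF p. 9)] [cite: Huybrechts2005, §3.3 Prop. 3.3.13] -/
theorem existsUnique_wedgeFamily_wedge_eq {n : ℕ} (e : Fin (2 * (n + 2)) ≃ ι) {θ : Fin n → E [⋀^Fin 2]→L[ℝ] ℝ}
    (h11 : ∀ m (x y : E), θ m ![I • x, I • y] = θ m ![x, y]) (hpos : ∀ m (v : E), v ≠ 0 → 0 < θ m ![I • v, v])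
    (C : E [⋀^Fin (2 * n + 2)]→L[ℝ] ℂ) :
    ∃! A : E [⋀^Fin 2]→L[ℝ] ℂ, (wedgeFamily n fun m ↦ ofRealForm (-(θ m))).wedge A = C :=
  (wedgeFamily_wedge_bijective Φ e h11 hpos).existsUnique C

include Φ in
/-- **Real classes**: `Ω ∧ α_ℂ = 0` for a real class `α ∈ H²(X, ℝ)` forces `α = 0`.
[cite: DinhNguyen2006, §4 Remarks 4.2 (arXiv PDF p. 9)] -/
theorem eq_zero_of_wedgeFamily_wedge_ofRealForm_eq_zero {n : ℕ} (e : Fin (2 * (n + 2)) ≃ ι)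
    {θ : Fin n → E [⋀^Fin 2]→L[ℝ] ℝ} (h11 : ∀ m (x y : E), θ m ![I • x, I • y] = θ m ![x, y])
    (hpos : ∀ m (v : E), v ≠ 0 → 0 < θ m ![I • v, v]) {α : E [⋀^Fin 2]→L[ℝ] ℝ}
    (h : (wedgeFamily n fun m ↦ ofRealForm (-(θ m))).wedge (ofRealForm α) = 0) : α = 0 :=
  ofRealForm_injective (by
    rw [ofRealForm_zero]
    exact wedgeFamily_wedge_injective Φ e h11 hpos (by simp only [h, ContinuousAlternatingMap.wedge_zero]))

include Φ in
/-- **`Ω = ω_1 ∧ ⋯ ∧ ω_n ≠ 0`** for Kähler classes on a torus of dimension `n + 2` (indeed `Ω ∧ ·` is injective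
on `H² ≠ 0`). [cite: DinhNguyen2006, §4 (arXiv PDF p. 9: "`[Ω] ∧ [ω]` does not vanish")] -/
theorem wedgeFamily_background_ne_zero {n : ℕ} (e : Fin (2 * (n + 2)) ≃ ι) {θ : Fin n → E [⋀^Fin 2]→L[ℝ] ℝ}
    (h11 : ∀ m (x y : E), θ m ![I • x, I • y] = θ m ![x, y]) (hpos : ∀ m (v : E), v ≠ 0 → 0 < θ m ![I • v, v]) :
    (wedgeFamily n fun m ↦ ofRealForm (-(θ m))) ≠ 0 := by
  intro h0
  haveI := finiteDimensional_complex Φ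
  have hg : finrank ℂ E = n + 2 := finrank_eq_of_finTwoMulEquiv Φ e
  obtain ⟨v, hv⟩ := Module.finrank_pos_iff_exists_ne_zero.1 (by rw [hg]; omega : 0 < finrank ℂ E)
  obtain ⟨ω, hω11, hωpos⟩ := exists_pos_typeOneOne Φ
  have hω0 : ofRealForm ω ≠ 0 := by
    intro h
    have h' : ω = 0 := ofRealForm_injective (h.trans ofRealForm_zero.symm)
    have := hωpos v hv
    rw [h', ContinuousAlternatingMap.coe_zero, Pi.zero_apply] at this
    exact lt_irrefl _ this
  exact hω0 (wedgeFamily_wedge_injective Φ e h11 hpos (by simp only [h0, ContinuousAlternatingMap.zero_wedge]))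

end HardLefschetz

/-! ## §4 Prop. 2.1 (a) for `p + q = 2`: `Ω ∧ · : Λ^{p,q} ⥲ Λ^{n+p, n+q} = Λ^{g-q, g-p}` -/

section Types

variable {ι : Type*} [Fintype ι] [DecidableEq ι] {E : Type*} [NormedAddCommGroup E] [NormedSpace ℂ E]
  (Φ : (ι → ℝ) ≃L[ℝ] E)

omit [Fintype ι] [DecidableEq ι] in
/-- **Types add: `Ω ∧ Λ^{p,q} ⊆ Λ^{n+p, n+q}`** for a `(1,1)` background `Θ = ((-θ_m)_ℂ)_m` of length `n`.
[cite: VoisinHodgeI2002, §2.3.1] [cite: DinhNguyen2006, §2 Prop. 2.1 (a) (arXiv PDF p. 5)] -/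
theorem wedgeFamily_wedge_mem_typeSubmodule {n p q : ℕ} {θ : Fin n → E [⋀^Fin 2]→L[ℝ] ℝ}
    (h11 : ∀ m (x y : E), θ m ![I • x, I • y] = θ m ![x, y]) {A : E [⋀^Fin 2]→L[ℝ] ℂ} (hpq : p + q = 2)
    (hA : A ∈ typeSubmodule E 2 p q) :
    (wedgeFamily n fun m ↦ ofRealForm (-(θ m))).wedge A ∈ typeSubmodule E (2 * n + 2) (n + p) (n + q) := by
  have hΘ : ∀ m, IsOfTypeAt 1 1 (ofRealForm (-(θ m))) := fun m ↦ isOfTypeAt_one_one_ofRealForm fun x y ↦ by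
    rw [ContinuousAlternatingMap.neg_apply, ContinuousAlternatingMap.neg_apply, h11]
  exact ((isOfTypeAt_wedgeFamily hΘ).wedge (isOfTypeAt_of_mem_typeSubmodule hpq hA)).mem_typeSubmodule

/-- `C(n + 2, n + p) = C(n + 2, q)` for `p + q = 2`. [folklore] -/
private theorem choose_shift {n p q : ℕ} (hpq : p + q = 2) : (n + 2).choose (n + p) = (n + 2).choose q :=
  Nat.choose_symm_of_eq_add (by omega)

include Φ in
omit [DecidableEq ι] in
/-- **`dim_ℂ Λ^{n+p, n+q} = dim_ℂ Λ^{p,q} = C(g,p) C(g,q)`** for `p + q = 2` on a torus of dimension `g = n + 2`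
(`Λ^{n+p, n+q} = Λ^{g-q, g-p}` and `C(g, g-q) = C(g, q)`). [cite: Lange2023AbelianVarietiesComplex, §1.1.5 Prop. 1.1.23]
[cite: DinhNguyen2006, §2 Prop. 2.1 (a) (arXiv PDF p. 5)] -/
theorem finrank_typeSubmodule_shift_eq [FiniteDimensional ℂ E] {n p q : ℕ} (e : Fin (2 * (n + 2)) ≃ ι)
    (hpq : p + q = 2) :
    finrank ℂ (typeSubmodule E (2 * n + 2) (n + p) (n + q)) = finrank ℂ (typeSubmodule E 2 p q) := by
  have hg : finrank ℂ E = n + 2 := finrank_eq_of_finTwoMulEquiv Φ e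
  rw [finrank_typeSubmodule (k := 2 * n + 2) (p := n + p) (q := n + q) (by omega), finrank_typeSubmodule hpq, hg,
    choose_shift hpq, choose_shift ((add_comm q p).trans hpq), mul_comm]

include Φ in
/-- **Dinh–Nguyên Prop. 2.1 (a) in degree two on a complex torus: `A ↦ Ω ∧ A` is a bijection
`Λ^{p,q} ⥲ Λ^{n+p, n+q} = Λ^{g-q, g-p}`** for every `(p, q)` with `p + q = 2` ("The operator of multiplication by
`Ω` induces an isomorphism between `Λ^{p,q}(ℂⁿ)` and `Λ^{n-q,n-p}(ℂⁿ)`", here `dim = n + 2` and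
`Ω = ω_1 ∧ ⋯ ∧ ω_n`): injective by §3 and of equal dimensions `C(g,p) C(g,q)`.
[cite: DinhNguyen2006, §2 Prop. 2.1 (a) (arXiv PDF p. 5)] [cite: Timorin1998, Proposition 1]
[cite: Lange2023AbelianVarietiesComplex, §1.1.5 Prop. 1.1.23] -/
theorem wedgeFamily_wedge_bijective_typeSubmodule {n p q : ℕ} (e : Fin (2 * (n + 2)) ≃ ι)
    {θ : Fin n → E [⋀^Fin 2]→L[ℝ] ℝ} (h11 : ∀ m (x y : E), θ m ![I • x, I • y] = θ m ![x, y])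
    (hpos : ∀ m (v : E), v ≠ 0 → 0 < θ m ![I • v, v]) (hpq : p + q = 2) :
    Function.Bijective fun A : typeSubmodule E 2 p q ↦
      (⟨(wedgeFamily n fun m ↦ ofRealForm (-(θ m))).wedge A,
        wedgeFamily_wedge_mem_typeSubmodule h11 hpq A.2⟩ : typeSubmodule E (2 * n + 2) (n + p) (n + q)) := by
  haveI := finiteDimensional_complex Φ
  haveI := finiteDimensional_complexForms Φ e (k := 2) (by omega)
  haveI := finiteDimensional_complexForms Φ e (k := 2 * n + 2) (by omega)
  set L : (E [⋀^Fin 2]→L[ℝ] ℂ) →ₗ[ℂ] (E [⋀^Fin (2 * n + 2)]→L[ℝ] ℂ) :=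
    { toFun := fun A ↦ (wedgeFamily n fun m ↦ ofRealForm (-(θ m))).wedge A
      map_add' := fun A B ↦ ContinuousAlternatingMap.wedge_add_right _ _ _
      map_smul' := fun c A ↦ wedge_smul_right_complex c _ _ } with hL
  set L' : typeSubmodule E 2 p q →ₗ[ℂ] typeSubmodule E (2 * n + 2) (n + p) (n + q) :=
    L.restrict (p := typeSubmodule E 2 p q) (q := typeSubmodule E (2 * n + 2) (n + p) (n + q))
      fun A hA ↦ wedgeFamily_wedge_mem_typeSubmodule h11 hpq hA with hL'
  have hinj : Function.Injective L' := by
    intro A B h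
    apply Subtype.ext
    exact wedgeFamily_wedge_injective Φ e h11 hpos (congrArg Subtype.val h)
  change Function.Bijective L'
  exact ⟨hinj, (LinearMap.injective_iff_surjective_of_finrank_eq_finrank
    (finrank_typeSubmodule_shift_eq Φ e hpq).symm).1 hinj⟩

include Φ in
/-- **The case `(p,q) = (2,0)`: `Ω ∧ · : H^{2,0}(X) ⥲ H^{n+2, n}(X) = H^{g, g-2}(X)`** (`dim = C(g, 2)` on both sides).
[cite: DinhNguyen2006, §2 Prop. 2.1 (a) (arXiv PDF p. 5)] -/
theorem wedgeFamily_wedge_bijective_twoZero {n : ℕ} (e : Fin (2 * (n + 2)) ≃ ι)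
    {θ : Fin n → E [⋀^Fin 2]→L[ℝ] ℝ} (h11 : ∀ m (x y : E), θ m ![I • x, I • y] = θ m ![x, y])
    (hpos : ∀ m (v : E), v ≠ 0 → 0 < θ m ![I • v, v]) :
    Function.Bijective fun A : typeSubmodule E 2 2 0 ↦
      (⟨(wedgeFamily n fun m ↦ ofRealForm (-(θ m))).wedge A,
        wedgeFamily_wedge_mem_typeSubmodule h11 rfl A.2⟩ : typeSubmodule E (2 * n + 2) (n + 2) (n + 0)) :=
  wedgeFamily_wedge_bijective_typeSubmodule Φ e h11 hpos rfl

include Φ in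
/-- **The case `(p,q) = (1,1)`: `Ω ∧ · : H^{1,1}(X) ⥲ H^{n+1, n+1}(X) = H^{g-1, g-1}(X)`** (`dim = g²`; the operator form of
the tree's Poincaré-dual `mixedIntersectionForm_eq_zero_of_forall`). [cite: DinhNguyen2006, §2 Prop. 2.1 (a) (arXiv PDF p. 5)]
[cite: DinhNguyen2006, §4 (arXiv PDF p. 9: the set `𝓛_{n-2}`)] -/
theorem wedgeFamily_wedge_bijective_oneOne {n : ℕ} (e : Fin (2 * (n + 2)) ≃ ι)
    {θ : Fin n → E [⋀^Fin 2]→L[ℝ] ℝ} (h11 : ∀ m (x y : E), θ m ![I • x, I • y] = θ m ![x, y])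
    (hpos : ∀ m (v : E), v ≠ 0 → 0 < θ m ![I • v, v]) :
    Function.Bijective fun A : typeSubmodule E 2 1 1 ↦
      (⟨(wedgeFamily n fun m ↦ ofRealForm (-(θ m))).wedge A,
        wedgeFamily_wedge_mem_typeSubmodule h11 rfl A.2⟩ : typeSubmodule E (2 * n + 2) (n + 1) (n + 1)) :=
  wedgeFamily_wedge_bijective_typeSubmodule Φ e h11 hpos rfl

include Φ in
/-- **The case `(p,q) = (0,2)`: `Ω ∧ · : H^{0,2}(X) ⥲ H^{n, n+2}(X) = H^{g-2, g}(X)`.**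
[cite: DinhNguyen2006, §2 Prop. 2.1 (a) (arXiv PDF p. 5)] -/
theorem wedgeFamily_wedge_bijective_zeroTwo {n : ℕ} (e : Fin (2 * (n + 2)) ≃ ι)
    {θ : Fin n → E [⋀^Fin 2]→L[ℝ] ℝ} (h11 : ∀ m (x y : E), θ m ![I • x, I • y] = θ m ![x, y])
    (hpos : ∀ m (v : E), v ≠ 0 → 0 < θ m ![I • v, v]) :
    Function.Bijective fun A : typeSubmodule E 2 0 2 ↦
      (⟨(wedgeFamily n fun m ↦ ofRealForm (-(θ m))).wedge A,
        wedgeFamily_wedge_mem_typeSubmodule h11 rfl A.2⟩ : typeSubmodule E (2 * n + 2) (n + 0) (n + 2)) :=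
  wedgeFamily_wedge_bijective_typeSubmodule Φ e h11 hpos rfl

end Types

/-! ## §5 Abelian varieties: `Ω = c₁(L_1) ∧ ⋯ ∧ c₁(L_n)` for polarisations `L_m` -/

section RiemannForm

variable {ι : Type*} [Fintype ι] [DecidableEq ι] {E : Type*} [NormedAddCommGroup E] [NormedSpace ℂ E]
  (Φ : (ι → ℝ) ≃L[ℝ] E)

/-- **Mixed hard Lefschetz in degree two for polarisations**: `L_1, …, L_n` polarisations of an abelian variety
`X` of dimension `n + 2`: `A ↦ c₁(L_1) ∧ ⋯ ∧ c₁(L_n) ∧ A` is a bijection `H²(X, ℂ) ⥲ H^{2n+2}(X, ℂ)`.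
[cite: DinhNguyen2006, §4 Remarks 4.2 (arXiv PDF p. 9)] [cite: Lange2023AbelianVarietiesComplex, §5.1.2 (p. 244)] -/
theorem IsRiemannForm.wedgeFamily_wedge_bijective {n : ℕ} (e : Fin (2 * (n + 2)) ≃ ι)
    {θ : Fin n → E [⋀^Fin 2]→L[ℝ] ℝ} (hθ : ∀ m, IsRiemannForm Φ (θ m)) :
    Function.Bijective fun A : E [⋀^Fin 2]→L[ℝ] ℂ ↦ (wedgeFamily n fun m ↦ ofRealForm (-(θ m))).wedge A :=
  ComplexTorus.wedgeFamily_wedge_bijective Φ e (fun m ↦ (hθ m).1) (fun m ↦ (hθ m).2.2)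

/-- **Prop. 2.1 (a) for polarisations**: `c₁(L_1) ∧ ⋯ ∧ c₁(L_n) ∧ · : H^{p,q}(X) ⥲ H^{n+p, n+q}(X)` for `p + q = 2`.
[cite: DinhNguyen2006, §2 Prop. 2.1 (a) (arXiv PDF p. 5)] [cite: Lange2023AbelianVarietiesComplex, §5.1.2 (p. 244)] -/
theorem IsRiemannForm.wedgeFamily_wedge_bijective_typeSubmodule {n p q : ℕ} (e : Fin (2 * (n + 2)) ≃ ι)
    {θ : Fin n → E [⋀^Fin 2]→L[ℝ] ℝ} (hθ : ∀ m, IsRiemannForm Φ (θ m)) (hpq : p + q = 2) :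
    Function.Bijective fun A : typeSubmodule E 2 p q ↦
      (⟨(wedgeFamily n fun m ↦ ofRealForm (-(θ m))).wedge A,
        wedgeFamily_wedge_mem_typeSubmodule (fun m ↦ (hθ m).1) hpq A.2⟩ :
          typeSubmodule E (2 * n + 2) (n + p) (n + q)) :=
  ComplexTorus.wedgeFamily_wedge_bijective_typeSubmodule Φ e (fun m ↦ (hθ m).1) (fun m ↦ (hθ m).2.2) hpq

end RiemannForm

end ComplexTorus

end Literature.Geometry.Kaehler

end
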